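import Literature.AlgebraicGeometry.HodgeTheory.AbelianVarietyRingActionTorsionBlockCount
import Literature.AlgebraicGeometry.AbelianSchemes.TorsionSectionsPointsCount
import Literature.AlgebraicGeometry.AbelianSchemes.AbelianSchemeOverFibreDim
import HarnessLib

/-!
# Socket (S-H) closed over a complex geometric point: the `w`-block of `A[p^∞]` at a special point has height `2ef`
# for an abelian scheme of relative dimension `[F : ℚ]` with `𝒪_F`-multiplication

Topic `Literature/AlgebraicGeometry/HodgeTheory`; namespace `Literature.AlgebraicGeometry.HodgeTheory.RingAction`.  THEOREMS ONLY (no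
definition, no named fact, no instance, no notation, no `sorry`).  Cell `hodgecm-mathlib` (D-0151), FLOOR 0, P6 «MOD programme» (crux
hLiu418 = stmt-HodgeConjecture-24832, `--supports`): FILE 4 (JUNCTION WITH THE K∕BT CHAIN) of the GEN organ **(S-H-A) «TATE∕BETTI-MODULE
COMPARISON FOR THE `e_w`-COUNT»** (A-p18 (g30), 2026-09-01).  ★ DEAL 9 v2 `TorsionSectionsPointsCount` §4
(`RingAction.hrank_specialFibre_of_natCard_fixedPoints_torsionPoints`) turns a COUNT of the `pⁿ`-torsion points of the geometric generic
fibre `𝒜_Ω` fixed by `ι_Ω(a_n)` — at ANY geometric point `Ω` of characteristic `0` of the local base `Spec R₀` — into the block height of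
the `w`-block of `𝒜_κ[p^∞]` at any field-valued point `κ`; ★ FILE 3 `AbelianVarietyRingActionTorsionBlockCount` computes that count OVER `ℂ`
(`= p^{n·2ef}`, from `H₁(A(ℂ); ℤ)` — RANK FREE OF CHARGE).  THIS FILE takes `Ω := ℂ`: for an abelian scheme `𝒜 → Spec R₀` of relative
dimension `[F : ℚ]` with an `𝒪_F`-action and ANY ring homomorphism `R₀ → ℂ` (a complex point of the base), the socket (S-H) `hrank` of the
K∕BT desk's ED. 6 line `Cruxes/HLiu418/Lines/F0_P6d_BlockDocking.lean` holds with `h₁ := 2*e*f` at every field-valued point of `Spec R₀` — no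
PEL ∕ Kottwitz input, no `p`-adic comparison, no choice of `Ω = F̄_w`.  What the record must still supply per special point `x̄`: a local ring
`R₀` under `x̄` carrying the tuple (★ `GaloisThickeningIntegralPackage` ∕ `extendPoint`) together with ONE ring homomorphism `R₀ → ℂ`
(e.g. `R₀ ⊆ ℚ̄ ↪ ℂ` for a strict henselisation inside `ℚ̄`, or the local ring of the model at `x̄` through its function field and `ι₁`).

* §1 `exists_ringHom_End_of_ringAction` — a ring action `act : RingAction O X` on an abelian scheme over a field `K` IS a ring homomorphism
  `ι₀ : O →+* End (X.toAffine.toAbelianVariety)` with `(ι₀ r) = act.i r` on the underlying group-scheme maps (print's «`ι : 𝒪 → End(A)`»).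
* §2 HEAD **`hrank_specialFibre_of_complexPoint`** — (S-H) with `h₁ = 2ef` from `gℂ : Spec ℂ → Spec R₀`, `dim = [F : ℚ]` and the block data
  `(w, e, 𝔟, f, a)` of ★ `BlockIdempotentFamily`; and the `hcount`-form **`natCard_fixedPoints_torsionPoints_baseChange_complexPoint`** it rests on.

HC_CM is proved only modulo the printed citations until rung 0 closes; this file is generic and changes no count.

THE PRINT.  [RapoportSmithlingZhang2020Diagonal] §4.1 (p. 17): «`A[p^∞] = ∏_{w∣p} A[w^∞]` … `A[w^∞]` is a `p`-divisible group of height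
`n·[F_w : ℚ_p]`» (here `n = 2`); [Tate1967] §2 (2.1)–(2.4) (height of a `p`-divisible group, constancy on a connected base); [MumfordAV1970] §24
p. 237 (`T_p A = H₁ ⊗ ℤ_p` over `ℂ`); [Kottwitz1992] §5 p. 390 («`ι : 𝒪_B → End(A)`» a ring homomorphism).

## References
* [RapoportSmithlingZhang2020Diagonal] M. Rapoport, B. Smithling, W. Zhang, *Arithmetic diagonal cycles on unitary Shimura varieties*,
  Compos. Math. 156 (2020), §4.1 (p. 17).
* [Tate1967] J. T. Tate, *p-divisible groups*, Proc. Conf. Local Fields (Driebergen 1966), Springer 1967, §2 (2.1)–(2.4).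
* [MumfordAV1970] D. Mumford, *Abelian Varieties* (1970), §24 p. 237.
* [Kottwitz1992] R. Kottwitz, *Points on some Shimura varieties over finite fields*, JAMS 5 (1992), §5 (p. 390).
-/

set_option autoImplicit false

noncomputable section

-- `X.toAffine.toAbelianVariety.X = X.X` is definitional only above `instances` transparency (as in ★ `TorsionSectionsPointsCount`).
set_option backward.isDefEq.respectTransparency false

open CategoryTheory CategoryTheory.Limits AlgebraicGeometry
open scoped MonObj

namespace Literature.AlgebraicGeometry.HodgeTheory

namespace RingAction

open Literature.AlgebraicGeometry.AbelianSchemes Literature.AlgebraicGeometry.AbelianSchemes.AbelianSchemeOver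
open Literature.AlgebraicGeometry.AbelianSchemes.AbelianSchemeOver.RingAction
open Literature.AlgebraicGeometry.GroupSchemes Literature.AlgebraicGeometry.GroupSchemes.IsRingActionBT
open Literature.AlgebraicGeometry.Motives Literature.AlgebraicGeometry.Motives.AbelianVariety
open Literature.AlgebraicGeometry.HodgeTheory.AbelianVariety
open Literature.RingTheory.DedekindDomain NumberField

/-! ## §1 A ring action on an abelian scheme over a field is a ring homomorphism into `End` of the abelian variety -/

/-- **`ι : O → End(A)` is a ring homomorphism** — the tree's `RingAction` (ring structure on `End_S(A)` spelled out by hand: `i (ab) = i b ≫ i a`,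
`i (a + b) = i a · i b`, `i 0 = 1`, `i 1 = 𝟙`) read, over a field, as an honest `O →+* End (X.toAffine.toAbelianVariety)` (`End`'s product is
`f * g = g ≫ f`, its sum the group law of `Hom`, ★ `hom_hom_hom_add` ∕ `hom_hom_hom_zero`), with the SAME underlying group-scheme maps.
[cite: Kottwitz1992, §5 (p. 390)] -/
theorem exists_ringHom_End_of_ringAction {K : Type} [Field K] {X : AbelianSchemeOver (Spec (.of K))} [IsCommMonObj X.X]
    {O : Type*} [CommRing O] (act : RingAction O X) :
    ∃ ι₀ : O →+* End X.toAffine.toAbelianVariety, ∀ r : O, (End.asHom (ι₀ r)).hom.hom.hom = act.i r := by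
  let φ : O → End X.toAffine.toAbelianVariety := fun r =>
    haveI := act.isMonHom_i r
    (InducedCategory.homMk (Grp.ofHom (A := X.X) (B := X.X) (act.i r)) :
      X.toAffine.toAbelianVariety ⟶ X.toAffine.toAbelianVariety)
  have hφ : ∀ r, (End.asHom (φ r)).hom.hom.hom = act.i r := fun r => rfl
  refine ⟨{ toFun := φ, map_one' := ?_, map_mul' := ?_, map_zero' := ?_, map_add' := ?_ }, hφ⟩
  · apply Motives.AbelianVariety.hom_ext
    change act.i 1 = (𝟙 X.toAffine.toAbelianVariety : X.toAffine.toAbelianVariety ⟶ X.toAffine.toAbelianVariety).hom.hom.hom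
    rw [act.i_one]
    rfl
  · intro r s
    apply Motives.AbelianVariety.hom_ext
    change act.i (r * s) = (φ s ≫ φ r).hom.hom.hom
    rw [act.i_mul]
    rfl
  · apply Motives.AbelianVariety.hom_ext
    change act.i 0 = (0 : X.toAffine.toAbelianVariety ⟶ X.toAffine.toAbelianVariety).hom.hom.hom
    rw [act.i_zero]
    rfl
  · intro r s
    apply Motives.AbelianVariety.hom_ext
    change act.i (r + s) = (φ r + φ s).hom.hom.hom
    rw [hom_hom_hom_add, act.i_add]
    show act.i r * act.i s = act.i r * act.i s
    rfl

/-! ## §2 Socket (S-H) over a complex geometric point -/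

/-- **THE `hcount` OVER `ℂ` IN THE K∕BT CURRENCY**: for `𝒜 → Spec R₀` of relative dimension `[F : ℚ]` with `act : RingAction (𝓞 F) 𝒜`, a
complex point `gℂ : Spec ℂ → Spec R₀`, and the block data of a prime `w ∣ p` of `𝒪_F` (`#(𝒪_F∕w) = p^f`, `(p) = w^e 𝔟`, `w ⊔ 𝔟 = ⊤`,
`a_n ≡ 1 (w^{en})`, `a_n ≡ 0 (𝔟ⁿ)`): the `pⁿ`-torsion points of the complex abelian variety `𝒜_ℂ` fixed by `ι_ℂ(a_n)` number `p ^ (n * (2*e*f))`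
— ★ FILE 3 `natCard_fixedPoints_torsionPoints_blockIdempotent` through the ring homomorphism of §1 and ★ `dim_fibre_of_isOfRelDim`
(`dim 𝒜_ℂ = [F : ℚ]`), in EXACTLY the `hcount` spelling of ★ `hrank_specialFibre_of_natCard_fixedPoints_torsionPoints`.
[cite: RapoportSmithlingZhang2020Diagonal, §4.1 (p. 17)] [cite: MumfordAV1970, §24 p. 237] -/
theorem natCard_fixedPoints_torsionPoints_baseChange_complexPoint {R₀ : Type} [CommRing R₀]
    {𝒜 : AbelianSchemeOver (Spec (.of R₀))} [IsCommMonObj 𝒜.X] {F : Type} [Field F] [NumberField F]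
    (hg : 𝒜.IsOfRelDim (Module.finrank ℚ F)) (act : RingAction (𝓞 F) 𝒜)
    {p : ℕ} (hp : p ≠ 0) (w : Ideal (𝓞 F)) [w.IsMaximal] (hw0 : w ≠ ⊥) {f : ℕ} (hf : Nat.card (𝓞 F ⧸ w) = p ^ f)
    {e : ℕ} {𝔟 : Ideal (𝓞 F)} (hx : Ideal.span {(p : 𝓞 F)} = w ^ e * 𝔟) (hcop : w ⊔ 𝔟 = ⊤)
    (a : ℕ → 𝓞 F) (ha1 : ∀ n, a n - 1 ∈ w ^ (e * n)) (ha2 : ∀ n, a n ∈ 𝔟 ^ n)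
    (gℂ : Spec (.of ℂ) ⟶ Spec (.of R₀)) [IsCommMonObj (𝒜.baseChange gℂ).X] (n : ℕ) :
    Nat.card {P : (𝒜.baseChange gℂ).toAffine.toAbelianVariety.torsionPoints ℂ ((p ^ n : ℕ) : ℤ) //
      (haveI := (act.baseChange gℂ).isMonHom_i (a n); IsMonHom.monoidHom ((act.baseChange gℂ).i (a n)) (specOver ℂ ℂ))
        (P : (𝒜.baseChange gℂ).toAffine.toAbelianVariety.Points ℂ) =
          (P : (𝒜.baseChange gℂ).toAffine.toAbelianVariety.Points ℂ)} = p ^ (n * (2 * e * f)) := by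
  obtain ⟨ι₀, hι₀⟩ := exists_ringHom_End_of_ringAction (act.baseChange gℂ)
  have hdim : Module.finrank ℚ F = (𝒜.baseChange gℂ).toAffine.toAbelianVariety.dim := (dim_fibre_of_isOfRelDim hg gℂ).symm
  rw [← natCard_fixedPoints_torsionPoints_blockIdempotent ι₀ hdim w hw0 hf hx hcop a ha1 ha2 hp n]
  haveI := (act.baseChange gℂ).isMonHom_i (a n)
  refine Nat.card_congr (Equiv.subtypeEquivRight fun P => ?_)
  rw [IsMonHom.monoidHom_apply, IsMonHom.monoidHom_apply, hι₀]

/-- **SOCKET (S-H) OVER A COMPLEX GEOMETRIC POINT — block height `h₁ = 2ef`.**  `𝒜 → Spec R₀` an abelian scheme of relative dimension `[F : ℚ]`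
over a local ring with `act : RingAction (𝓞 F) 𝒜`; `w ∣ p` a prime of `𝒪_F` with its block data `(e, 𝔟, f, a)` (★ `BlockIdempotentFamily`);
`gℂ : Spec ℂ → Spec R₀` ANY complex point of the base and `gκ : Spec κ → Spec R₀` ANY field-valued point.  Then the layers of the `w`-block
`ε_κ = β_κ(a)` of `𝒜_κ[p^∞]` have rank `p^{n·2ef}`: `rk_s (Fix ε_κ)_n = p ^ (n * (2 * e * f))` — the `hrank` binder of the K∕BT ED. 6 line
(★ `F0P6dBlockDocking.blockDocking_of_line`, `h₁ := 2*e*f`) at the special point, from ★ DEAL 9 v2 §4 fed with the complex count above.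
«`A[w^∞]` has height `2·[F_w : ℚ_p] = 2ef`.» [cite: RapoportSmithlingZhang2020Diagonal, §4.1 (p. 17)] [cite: Tate1967, §2 (2.1)–(2.4)] -/
theorem hrank_specialFibre_of_complexPoint {R₀ : Type} [CommRing R₀] [IsLocalRing R₀]
    {𝒜 : AbelianSchemeOver (Spec (.of R₀))} [IsCommMonObj 𝒜.X] {F : Type} [Field F] [NumberField F]
    (hg : 𝒜.IsOfRelDim (Module.finrank ℚ F)) (act : RingAction (𝓞 F) 𝒜)
    {p : ℕ} (hp : p ≠ 0) (w : Ideal (𝓞 F)) [w.IsMaximal] (hw0 : w ≠ ⊥) {f : ℕ} (hf : Nat.card (𝓞 F ⧸ w) = p ^ f)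
    {e : ℕ} {𝔟 : Ideal (𝓞 F)} (hx : Ideal.span {(p : 𝓞 F)} = w ^ e * 𝔟) (hcop : w ⊔ 𝔟 = ⊤)
    (a : ℕ → 𝓞 F) (ha1 : ∀ n, a n - 1 ∈ w ^ (e * n)) (ha2 : ∀ n, a n ∈ 𝔟 ^ n)
    (gℂ : Spec (.of ℂ) ⟶ Spec (.of R₀)) [IsCommMonObj (𝒜.baseChange gℂ).X]
    {κ : Type} [Field κ] (gκ : Spec (.of κ) ⟶ Spec (.of R₀)) [IsCommMonObj (𝒜.baseChange gκ).X] (n : ℕ) (s : ↥(Spec (.of κ))) :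
    (((isRingActionBT_pDivisibleGroupMap (act.baseChange gκ) hp (hg.baseChange gκ)).homOfCompatibleFamily a
        (sub_mem_span_pow hx hcop ha1 ha2)).fixLayer n).hom.finrank s = p ^ (n * (2 * e * f)) :=
  RingAction.hrank_specialFibre_of_natCard_fixedPoints_torsionPoints hp hg act a (sub_mem_span_pow hx hcop ha1 ha2)
    (mul_self_sub_mem_span_pow hx hcop ha1 ha2) gℂ (by exact_mod_cast hp) gκ
    (fun m => natCard_fixedPoints_torsionPoints_baseChange_complexPoint hg act hp w hw0 hf hx hcop a ha1 ha2 gℂ m) n s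

end RingAction

end Literature.AlgebraicGeometry.HodgeTheory
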